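import Summits.HodgeConjecture.CorCM.IrreducibleOddWeightsMultiplicity
import HarnessLib

/-!
# Mai's multiplicity formula for FAMILIES of CM types: `dim U(Σ) = Σ_π (d_π / δ_π) · dim Σ_i Ev_i(π)`

COR-CM (cell `pub-hodgecm2`, binder seat `b16` gen 57, count-neutral claim MULTIPLICITY, file F4 — the family form of
F3 `CorCM/IrreducibleOddWeightsMultiplicity`, in the setting of `Literature/…/CMTypeRankFamilies` (a group `G` acting
slot by slot on `⊔_i E_i`, types `Φ_i ⊆ E_i`, the family type `Σ = sigmaType Φ`, Shimura's antisymmetric spans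
`U(Φ_i) = antiSpan G (Φ_i)`, `U(Σ)`, `rank = dim U + 1`); theorems only, no definition, no named fact, no `sorry`).
NEW as stated, hence under `Summits/`.  HONEST FRAMING: the rank of a family of CM types — `dim Hg(∏_i A_i) = rank − 1`
for CM abelian varieties `A_i` of types `(K_i, Φ_i)`, `E_i = Hom(K_i, ℂ)`, `G = Aut(ℂ)` — as a closed multiplicity count
"for NAMED configurations" (kernel, unconditional) for INT-4 «what is known»; NO hypothesis on the slots (any CM
fields, any types); `HC_CM` is neither used nor asserted.

Local notation (no definition): `𝒪[G, w]` orbit span, `Ev[G, π, w]` evaluation space (F1); here moreover the SLOT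
evaluation spaces `Ev_i(π) = Ev[G, π, u_1(Φ_i)] = {T(u_1(Φ_i)) : T : ℚ^{E_i} → V equivariant} ≤ V` — exactly the
"evaluation subspaces" of `Literature/…/CMTypeRankEvaluationCriterion` (there: `U(Σ) = ⊕_i U(Φ_i)` iff they are
linearly independent in every irreducible `V`; "states no single-type formula") — now COUNTED:

* §1 `evalSpace_antiVec_sigmaType_eq_iSup` — **`Ev[G, π, u_1(Σ)] = Σ_i Ev_i(π)`** (as subspaces of `V`, any
  representation): an equivariant `T` on `ℚ^{⊔ E_i}` is read slot by slot (`T ∘ ext_i`), and slot maps `T_i` are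
  reassembled as `Σ_i T_i ∘ res_i`.
* §2 **`finrank_antiSpan_sigmaType_eq_sum`** — for pairwise non-isomorphic irreducible `(π_k, V_k)` covering `U(Σ)`:
  `δ_k ∣ dim Σ_i Ev_i(π_k)` and **`dim U(Σ) = Σ_k d_k · (dim Σ_i Ev_i(π_k) / δ_k)`** (`d_k = dim V_k`,
  `δ_k = dim End_G V_k`); CM types: **`typeRank_sigmaType_eq_sum_add_one`** (`rank(Σ) = 1 + Σ_k …`, i.e.
  `dim MT(∏_i A_i) = 1 + Σ_π (d_π/δ_π) · dim Σ_i Ev_i(π)`); ONE slot: **`finrank_antiSpan_eq_sum`**,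
  `typeRank_eq_sum_add_one` — Mai's identity `rank(K, S) = 1 + Σ_π d_π rank π(τ)` over `ℚ` on an ARBITRARY `G`-set
  (non-Galois `K`: `Ev_Φ(π)` replaces the column space of `π(τ)`).
* §3 **`sum_filter_finrank_le_finrank_antiSpan_sigmaType`** — MAI'S PROP. 1 FOR FAMILIES: `rank(Σ) − 1 ≥ Σ_k d_k` over
  the `k` touched by some member (`Ev_i(π_k) ≠ 0` for some `i`).
* §4 `cover_sigmaType_of_forall` — the covering hypothesis for `U(Σ)` follows from coverings of the members `U(Φ_i)`
  (a non-zero stable `P ≤ U(Σ)` restricts non-trivially to some slot, onto a stable subspace of `U(Φ_i)`).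

Sequels: F5 `CorCM/IrreducibleOddWeightsMultiplicityTransitive` (transitive slots: `Ev_i(π) = π(α_i) V^{H_i}` by
Frobenius reciprocity), F6 CM fields.

## References

* [Mai1989] L. Mai, *Lower bounds for the ranks of CM types*, J. Number Theory 32 (1989), §2 Prop. 1 (proof).
* [Kubota1965] T. Kubota, *On the field extension by complex multiplication*, Trans. AMS 118 (1965), Lemma 2.
* [Deligne1982HodgeCycles] P. Deligne, *Hodge cycles on abelian varieties*, LNM 900 (1982), I Ex. 3.7 (c).
* [Gordon1999HodgeAVSurvey] B. B. Gordon, *A survey of the Hodge conjecture for abelian varieties*, §3, 9.4.1, 9.4.4.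
-/

set_option autoImplicit false

noncomputable section

open scoped BigOperators

universe u u' v w

namespace Summit.HodgeConjecture.CorCM.IrrOdd

open Literature.NumberTheory.ComplexMultiplication

variable {G : Type w} [Group G]

/-- The orbit span `𝒪[G, w] = span_ℚ {x ↦ w (g • x) : g ∈ G}` (local notation, no definition). -/
local notation3 (prettyPrint := false) "𝒪[" G' ", " w "]" =>
  Submodule.span ℚ (Set.range fun g : G' => fun x => w (g • x))

/-- The evaluation space `Ev[G, π, w] = {T w : T equivariant}` (local notation, no definition). -/
local notation3 (prettyPrint := false) "Ev[" G' ", " π ", " w "]" =>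
  Submodule.span ℚ {v | ∃ T : (_ → ℚ) →ₗ[ℚ] _,
    (∀ (g : G') (f : _ → ℚ), T (fun x => f (g⁻¹ • x)) = π g (T f)) ∧ T w = v}

variable {I : Type u} {E : I → Type v} [∀ i, MulAction G (E i)]

/-! ### §1 The evaluation space of the family type is the sum of the slot evaluation spaces -/

section Slots

variable {V : Type*} [AddCommGroup V] [Module ℚ V] [DecidableEq I]

/-- Reading an equivariant map on `ℚ^{⊔ E_i}` on the slot `i` (`T ∘ ext_i`) gives an equivariant map on `ℚ^{E_i}`.
[cite: Gordon1999HodgeAVSurvey, §3 Theorem (proof)] -/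
theorem equivariant_comp_slotExt (π : Representation ℚ G V) (T : ((Σ i, E i) → ℚ) →ₗ[ℚ] V)
    (hT : ∀ (g : G) (f : (Σ i, E i) → ℚ), T (fun x => f (g⁻¹ • x)) = π g (T f)) (i : I) (g : G) (a : E i → ℚ) :
    (T ∘ₗ slotExt i) (fun s => a (g⁻¹ • s)) = π g ((T ∘ₗ slotExt i) a) := by
  rw [LinearMap.comp_apply, LinearMap.comp_apply, ← slotExt_comp_smul i a g⁻¹, hT]

omit [DecidableEq I] in
/-- The slot restriction `res_i : ℚ^{⊔ E_i} → ℚ^{E_i}` commutes with the action. [folklore] -/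
theorem funLeft_mk_comp_smul' (i : I) (f : (Σ i, E i) → ℚ) (g : G) :
    LinearMap.funLeft ℚ ℚ (Sigma.mk i) (fun x => f (g • x)) =
      fun s => LinearMap.funLeft ℚ ℚ (Sigma.mk i) f (g • s) :=
  rfl

omit [DecidableEq I] in
/-- Precomposing an equivariant slot map with the slot restriction gives an equivariant map on `ℚ^{⊔ E_i}`. [folklore] -/
theorem equivariant_comp_funLeft_mk (π : Representation ℚ G V) (i : I) (Ti : (E i → ℚ) →ₗ[ℚ] V)
    (hTi : ∀ (g : G) (a : E i → ℚ), Ti (fun s => a (g⁻¹ • s)) = π g (Ti a)) (g : G) (f : (Σ i, E i) → ℚ) :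
    (Ti ∘ₗ LinearMap.funLeft ℚ ℚ (Sigma.mk i)) (fun x => f (g⁻¹ • x)) =
      π g ((Ti ∘ₗ LinearMap.funLeft ℚ ℚ (Sigma.mk i)) f) := by
  rw [LinearMap.comp_apply, LinearMap.comp_apply, funLeft_mk_comp_smul', hTi]

/-- An equivariant map on `ℚ^{⊔ E_i}` evaluates on `u_1(Σ)` as `Σ_i (T ∘ ext_i)(u_1(Φ_i))`.
[cite: Deligne1982HodgeCycles, I Ex. 3.7 (c) (p. 26)] -/
theorem apply_antiVec_sigmaType_eq_sum [Fintype I] (Φ : ∀ i, Set (E i)) (T : ((Σ i, E i) → ℚ) →ₗ[ℚ] V) :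
    T (antiVec (sigmaType Φ) (1 : G)) = ∑ i, (T ∘ₗ slotExt i) (antiVec (Φ i) (1 : G)) := by
  rw [antiVec_sigmaType_eq_sigmaLift, sigmaLift_eq_sum_slotExt, map_sum]
  rfl

/-- **`Ev[G, π, u_1(Σ)] = Σ_i Ev[G, π, u_1(Φ_i)]`**: the evaluation space of the family type is the SUM of the
slot evaluation spaces, for EVERY representation `(π, V)`. [cite: Mai1989, §2 Prop. 1 (proof)] -/
theorem evalSpace_antiVec_sigmaType_eq_iSup [Fintype I] (π : Representation ℚ G V) (Φ : ∀ i, Set (E i)) :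
    Ev[G, π, antiVec (sigmaType Φ) (1 : G)] = ⨆ i, Ev[G, π, antiVec (Φ i) (1 : G)] := by
  apply le_antisymm
  · rw [evalSpace_le_iff]
    intro T hT
    rw [apply_antiVec_sigmaType_eq_sum]
    exact Submodule.sum_mem _ fun i _ => Submodule.mem_iSup_of_mem i
      (Submodule.subset_span ⟨T ∘ₗ slotExt i, equivariant_comp_slotExt π T hT i, rfl⟩)
  · refine iSup_le fun i => ?_
    rw [evalSpace_le_iff]
    intro Ti hTi
    refine Submodule.subset_span ⟨Ti ∘ₗ LinearMap.funLeft ℚ ℚ (Sigma.mk i),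
      equivariant_comp_funLeft_mk π i Ti hTi, ?_⟩
    rw [LinearMap.comp_apply, funLeft_mk_antiVec_sigmaType]

end Slots

/-! ### §2 The multiplicity formula for `U(Σ)` and for one type -/

section Formula

variable [Fintype I] [∀ i, Fintype (E i)] {K : Type u'} [Fintype K] {V : K → Type*}
  [∀ k, AddCommGroup (V k)] [∀ k, Module ℚ (V k)] [∀ k, FiniteDimensional ℚ (V k)]

/-- **MAI'S MULTIPLICITY FORMULA FOR A FAMILY OF TYPES** (any group `G`, any slots, any types).  For pairwise
non-isomorphic irreducible `ℚ`-representations `(π_k, V_k)` covering `U(Σ)`:  `δ_k ∣ dim Σ_i Ev_i(π_k)` and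
**`dim U(Σ) = Σ_k d_k · (dim Σ_i Ev_i(π_k) / δ_k)`**, `Ev_i(π) = {T(u_1(Φ_i)) : T : ℚ^{E_i} → V equivariant}`,
`d_k = dim V_k`, `δ_k = dim End_G(V_k)` — on Hodge groups `dim Hg(∏_i A_i) = Σ_π (d_π/δ_π) · dim Σ_i Ev_i(π)`.
[cite: Mai1989, §2 Prop. 1 (proof)] [cite: Kubota1965, Lemma 2] -/
theorem finrank_antiSpan_sigmaType_eq_sum (Φ : ∀ i, Set (E i)) (π : ∀ k, Representation ℚ G (V k))
    (hirr : ∀ k, (π k).IsIrreducible)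
    (hne : ∀ k l, k ≠ l → ∀ S : (π k).IntertwiningMap (π l), S = 0)
    (hcov : ∀ P : Submodule ℚ ((Σ i, E i) → ℚ), P ≤ antiSpan G (sigmaType Φ) → P ≠ ⊥ →
      (∀ (g : G) (f : (Σ i, E i) → ℚ), f ∈ P → (fun x => f (g • x)) ∈ P) →
      ∃ k, ∃ T : ((Σ i, E i) → ℚ) →ₗ[ℚ] V k,
        (∀ (g : G) (f : (Σ i, E i) → ℚ), T (fun x => f (g⁻¹ • x)) = π k g (T f)) ∧ ∃ f ∈ P, T f ≠ 0) :
    (∀ k, Module.finrank ℚ ((π k).IntertwiningMap (π k)) ∣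
        Module.finrank ℚ (⨆ i, Ev[G, π k, antiVec (Φ i) (1 : G)] : Submodule ℚ (V k))) ∧
      Module.finrank ℚ (antiSpan G (sigmaType Φ)) = ∑ k, Module.finrank ℚ (V k) *
        (Module.finrank ℚ (⨆ i, Ev[G, π k, antiVec (Φ i) (1 : G)] : Submodule ℚ (V k)) /
          Module.finrank ℚ ((π k).IntertwiningMap (π k))) := by
  classical
  have hO : 𝒪[G, antiVec (sigmaType Φ) (1 : G)] = antiSpan G (sigmaType Φ) := orbitSpan_antiVec_one _
  rw [← hO] at hcov ⊢
  obtain ⟨hdvd, hsum⟩ := finrank_orbitSpan_eq_sum (antiVec (sigmaType Φ) (1 : G)) π hirr hne hcov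
  have hE : ∀ k, Module.finrank ℚ Ev[G, π k, antiVec (sigmaType Φ) (1 : G)] =
      Module.finrank ℚ (⨆ i, Ev[G, π k, antiVec (Φ i) (1 : G)] : Submodule ℚ (V k)) := fun k => by
    rw [evalSpace_antiVec_sigmaType_eq_iSup]
  refine ⟨fun k => hE k ▸ hdvd k, ?_⟩
  rw [hsum]
  exact Finset.sum_congr rfl fun k _ => by rw [hE k]

/-- **CM types: `rank(Σ) = 1 + Σ_k d_k · (dim Σ_i Ev_i(π_k) / δ_k)`**, i.e. `dim MT(∏_i A_i) = 1 + Σ_π (d_π/δ_π) ·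
dim Σ_i Ev_i(π)`. [cite: Mai1989, §2 Prop. 1 (proof)] [cite: Shimura1998, §32.10] -/
theorem typeRank_sigmaType_eq_sum_add_one [Nonempty (Σ i, E i)] {ρ : G} {Φ : ∀ i, Set (E i)}
    (h : ∀ i, IsCMTypeWith ρ (Φ i)) (π : ∀ k, Representation ℚ G (V k))
    (hirr : ∀ k, (π k).IsIrreducible)
    (hne : ∀ k l, k ≠ l → ∀ S : (π k).IntertwiningMap (π l), S = 0)
    (hcov : ∀ P : Submodule ℚ ((Σ i, E i) → ℚ), P ≤ antiSpan G (sigmaType Φ) → P ≠ ⊥ →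
      (∀ (g : G) (f : (Σ i, E i) → ℚ), f ∈ P → (fun x => f (g • x)) ∈ P) →
      ∃ k, ∃ T : ((Σ i, E i) → ℚ) →ₗ[ℚ] V k,
        (∀ (g : G) (f : (Σ i, E i) → ℚ), T (fun x => f (g⁻¹ • x)) = π k g (T f)) ∧ ∃ f ∈ P, T f ≠ 0) :
    typeRank G (sigmaType Φ) = 1 + ∑ k, Module.finrank ℚ (V k) *
        (Module.finrank ℚ (⨆ i, Ev[G, π k, antiVec (Φ i) (1 : G)] : Submodule ℚ (V k)) /
          Module.finrank ℚ ((π k).IntertwiningMap (π k))) := by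
  rw [(IsCMTypeWith.sigmaType h).typeRank_eq_finrank_antiSpan_add_one,
    (finrank_antiSpan_sigmaType_eq_sum Φ π hirr hne hcov).2, add_comm]

variable {Y : Type v} [MulAction G Y] [Fintype Y]

/-- **MAI'S IDENTITY OVER `ℚ` FOR ONE TYPE ON AN ARBITRARY `G`-SET**: `δ_k ∣ dim Ev_Φ(π_k)` and
**`dim U(Φ) = Σ_k d_k · (dim Ev_Φ(π_k) / δ_k)`** for pairwise non-isomorphic irreducibles covering `U(Φ)`, where
`Ev_Φ(π) = {T(u_1(Φ)) : T : ℚ^X → V equivariant}` — for `X = G` (Galois `K`) over `ℂ` this is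
"`rank(K, S) − 1 = Σ_{π odd} d_π rank π(τ)`". [cite: Mai1989, §2 Prop. 1 (proof)] [cite: Kubota1965, Lemma 2] -/
theorem finrank_antiSpan_eq_sum (Φ : Set Y) (π : ∀ k, Representation ℚ G (V k))
    (hirr : ∀ k, (π k).IsIrreducible)
    (hne : ∀ k l, k ≠ l → ∀ S : (π k).IntertwiningMap (π l), S = 0)
    (hcov : ∀ P : Submodule ℚ (Y → ℚ), P ≤ antiSpan G Φ → P ≠ ⊥ →
      (∀ (g : G) (f : Y → ℚ), f ∈ P → (fun x => f (g • x)) ∈ P) →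
      ∃ k, ∃ T : (Y → ℚ) →ₗ[ℚ] V k,
        (∀ (g : G) (f : Y → ℚ), T (fun x => f (g⁻¹ • x)) = π k g (T f)) ∧ ∃ f ∈ P, T f ≠ 0) :
    (∀ k, Module.finrank ℚ ((π k).IntertwiningMap (π k)) ∣ Module.finrank ℚ Ev[G, π k, antiVec Φ (1 : G)]) ∧
      Module.finrank ℚ (antiSpan G Φ) = ∑ k, Module.finrank ℚ (V k) *
        (Module.finrank ℚ Ev[G, π k, antiVec Φ (1 : G)] / Module.finrank ℚ ((π k).IntertwiningMap (π k))) := by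
  have hO : 𝒪[G, antiVec Φ (1 : G)] = antiSpan G Φ := orbitSpan_antiVec_one _
  rw [← hO] at hcov ⊢
  exact finrank_orbitSpan_eq_sum (antiVec Φ (1 : G)) π hirr hne hcov

/-- **CM type: `rank(Φ) = 1 + Σ_k d_k · (dim Ev_Φ(π_k) / δ_k)`** (`dim MT(A_Φ)`).
[cite: Mai1989, §2 Prop. 1 (proof)] [cite: Shimura1998, §32.10] -/
theorem typeRank_eq_sum_add_one [Nonempty Y] {ρ : G} {Φ : Set Y} (h : IsCMTypeWith ρ Φ)
    (π : ∀ k, Representation ℚ G (V k)) (hirr : ∀ k, (π k).IsIrreducible)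
    (hne : ∀ k l, k ≠ l → ∀ S : (π k).IntertwiningMap (π l), S = 0)
    (hcov : ∀ P : Submodule ℚ (Y → ℚ), P ≤ antiSpan G Φ → P ≠ ⊥ →
      (∀ (g : G) (f : Y → ℚ), f ∈ P → (fun x => f (g • x)) ∈ P) →
      ∃ k, ∃ T : (Y → ℚ) →ₗ[ℚ] V k,
        (∀ (g : G) (f : Y → ℚ), T (fun x => f (g⁻¹ • x)) = π k g (T f)) ∧ ∃ f ∈ P, T f ≠ 0) :
    typeRank G Φ = 1 + ∑ k, Module.finrank ℚ (V k) *
        (Module.finrank ℚ Ev[G, π k, antiVec Φ (1 : G)] / Module.finrank ℚ ((π k).IntertwiningMap (π k))) := by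
  rw [h.typeRank_eq_finrank_antiSpan_add_one, (finrank_antiSpan_eq_sum Φ π hirr hne hcov).2, add_comm]

end Formula

/-! ### §3 Mai's lower bound for families -/

section LowerBound

variable [Fintype I] [∀ i, Fintype (E i)] {K : Type u'} [Fintype K] {V : K → Type*}
  [∀ k, AddCommGroup (V k)] [∀ k, Module ℚ (V k)] [∀ k, FiniteDimensional ℚ (V k)]

/-- **MAI'S PROP. 1 FOR FAMILIES**: `Σ_{k touched} d_k ≤ dim U(Σ) = rank(Σ) − 1`, "touched" meaning that SOME
member has a non-zero evaluation space `Ev_i(π_k) ≠ 0` (for a simple type and `K` Galois every odd `π` with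
`π(τ) ≠ 0` is touched: Mai's `rank(K, S) ≥ 1 + Σ' d_π`). [cite: Mai1989, §2 Prop. 1] [cite: Gordon1999HodgeAVSurvey, 9.4.4] -/
theorem sum_filter_finrank_le_finrank_antiSpan_sigmaType [DecidableEq I] (Φ : ∀ i, Set (E i))
    (π : ∀ k, Representation ℚ G (V k)) (hirr : ∀ k, (π k).IsIrreducible)
    (hne : ∀ k l, k ≠ l → ∀ S : (π k).IntertwiningMap (π l), S = 0)
    (hcov : ∀ P : Submodule ℚ ((Σ i, E i) → ℚ), P ≤ antiSpan G (sigmaType Φ) → P ≠ ⊥ →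
      (∀ (g : G) (f : (Σ i, E i) → ℚ), f ∈ P → (fun x => f (g • x)) ∈ P) →
      ∃ k, ∃ T : ((Σ i, E i) → ℚ) →ₗ[ℚ] V k,
        (∀ (g : G) (f : (Σ i, E i) → ℚ), T (fun x => f (g⁻¹ • x)) = π k g (T f)) ∧ ∃ f ∈ P, T f ≠ 0) :
    ∑ k ∈ Finset.univ.filter (fun k => ∃ i, Ev[G, π k, antiVec (Φ i) (1 : G)] ≠ ⊥),
        Module.finrank ℚ (V k) ≤ Module.finrank ℚ (antiSpan G (sigmaType Φ)) := by
  classical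
  have hO : 𝒪[G, antiVec (sigmaType Φ) (1 : G)] = antiSpan G (sigmaType Φ) := orbitSpan_antiVec_one _
  rw [← hO] at hcov ⊢
  refine le_trans (le_of_eq (Finset.sum_congr ?_ fun _ _ => rfl))
    (sum_filter_finrank_le_finrank_orbitSpan (antiVec (sigmaType Φ) (1 : G)) π hirr hne hcov)
  refine Finset.filter_congr fun k _ => ?_
  rw [evalSpace_antiVec_sigmaType_eq_iSup, ne_eq, iSup_eq_bot, not_forall]

end LowerBound

/-! ### §4 Covering the family from coverings of the members -/

section Cover

variable {K : Type u'} {V : K → Type*} [∀ k, AddCommGroup (V k)] [∀ k, Module ℚ (V k)]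

/-- **The covering hypothesis for `U(Σ)` follows from coverings of the members**: if for every slot `i` every
non-zero stable subspace of `U(Φ_i)` is met by some equivariant `ℚ^{E_i} → V_k`, then every non-zero stable
subspace `P` of `U(Σ)` is met by some equivariant `ℚ^{⊔ E_i} → V_k` (restrict `P` to a slot where it is non-zero:
the image is stable and lies in `res_i U(Σ) = U(Φ_i)`). [cite: Gordon1999HodgeAVSurvey, §3 Theorem (proof)] -/
theorem cover_sigmaType_of_forall (Φ : ∀ i, Set (E i)) (π : ∀ k, Representation ℚ G (V k))
    (hcov : ∀ (i : I) (P : Submodule ℚ (E i → ℚ)), P ≤ antiSpan G (Φ i) → P ≠ ⊥ →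
      (∀ (g : G) (a : E i → ℚ), a ∈ P → (fun s => a (g • s)) ∈ P) →
      ∃ k, ∃ T : (E i → ℚ) →ₗ[ℚ] V k,
        (∀ (g : G) (a : E i → ℚ), T (fun s => a (g⁻¹ • s)) = π k g (T a)) ∧ ∃ a ∈ P, T a ≠ 0) :
    ∀ P : Submodule ℚ ((Σ i, E i) → ℚ), P ≤ antiSpan G (sigmaType Φ) → P ≠ ⊥ →
      (∀ (g : G) (f : (Σ i, E i) → ℚ), f ∈ P → (fun x => f (g • x)) ∈ P) →
      ∃ k, ∃ T : ((Σ i, E i) → ℚ) →ₗ[ℚ] V k,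
        (∀ (g : G) (f : (Σ i, E i) → ℚ), T (fun x => f (g⁻¹ • x)) = π k g (T f)) ∧ ∃ f ∈ P, T f ≠ 0 := by
  intro P hPU hP0 hPst
  -- a non-zero `f ∈ P` and a slot where it is non-zero
  obtain ⟨f, hfP, hf0⟩ := (Submodule.ne_bot_iff P).1 hP0
  have hslot : ∃ i, LinearMap.funLeft ℚ ℚ (Sigma.mk i) f ≠ 0 := by
    by_contra hall
    apply hf0
    funext x
    obtain ⟨i, s⟩ := x
    have hi : LinearMap.funLeft ℚ ℚ (Sigma.mk i) f = 0 := not_ne_iff.1 (not_exists.1 hall i)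
    exact congrFun hi s
  obtain ⟨i, hi⟩ := hslot
  -- the restricted subspace
  let Pi : Submodule ℚ (E i → ℚ) := P.map (LinearMap.funLeft ℚ ℚ (Sigma.mk i))
  have hPiU : Pi ≤ antiSpan G (Φ i) := by
    rw [← map_funLeft_mk_antiSpan_sigmaType Φ i]
    exact Submodule.map_mono hPU
  have hPi0 : Pi ≠ ⊥ := fun h => hi (by
    have hmem : LinearMap.funLeft ℚ ℚ (Sigma.mk i) f ∈ Pi := Submodule.mem_map_of_mem hfP
    rw [h, Submodule.mem_bot] at hmem
    exact hmem)
  have hPist : ∀ (g : G) (a : E i → ℚ), a ∈ Pi → (fun s => a (g • s)) ∈ Pi := by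
    rintro g _ ⟨f', hf', rfl⟩
    exact ⟨fun x => f' (g • x), hPst g f' hf', funLeft_mk_comp_smul' i f' g⟩
  obtain ⟨k, Ti, hTi, a, haPi, ha⟩ := hcov i Pi hPiU hPi0 hPist
  obtain ⟨f', hf'P, rfl⟩ := haPi
  exact ⟨k, Ti ∘ₗ LinearMap.funLeft ℚ ℚ (Sigma.mk i), equivariant_comp_funLeft_mk (π k) i Ti hTi, f', hf'P,
    by rwa [LinearMap.comp_apply]⟩

end Cover

end Summit.HodgeConjecture.CorCM.IrrOdd

end
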